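import Literature.MathematicalPhysics.KineticTheory.HardSphereEulerProofs
import Literature.Analysis.FluidPDE.HardSphereTranslation
import HarnessLib

/-!
# Translation invariance of the homogeneous hard-sphere Gibbs law and the uniform one-point marginal
# (helper file for stub `stub_frozenModulation`, line `cutoff-compactness-net`, crux
# `AntiMazurCoboundaries.ShearStressHalfDrude`, stmt-AtomisticToContinuum-14136)

For CONSTANT profiles `(a, u, θ)` the local Gibbs law `G_N = localGibbsLaw σ a u θ N Φ` of `N + 1`
hard spheres on the unit torus `𝕋³` has Lebesgue density `Z⁻¹ 𝟙_{no overlap}(x) ∏ᵢ a M_{1,u,θ}(vᵢ)`,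
a function of the minimal-image separations `xᵢ − xⱼ` and of the velocities only.  Hence `G_N` is
invariant under the DIAGONAL TRANSLATION of all positions `T_c z := (i ↦ (xᵢ + c, vᵢ))`, `c ∈ 𝕋³`
(`map_posShift_localGibbsLaw_const`; the translation preserves Lebesgue measure on the torus phase
space, `HardSphereFlow.measurePreserving_posShift_volume`, and the density, `canonicalDensity_const_posShift`).

Averaging the resulting identity `E_G[ψ(xᵢ + c) K] = E_G[ψ(xᵢ) K]` (for a `T_c`-invariant `K`) over
`c ∈ 𝕋³` (Haar probability measure, Tonelli/Fubini) gives the FACTORISATION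
`E_G[ψ(xᵢ) · K] = (∫_{𝕋³} ψ) · E_G[K]` — the one-point position marginal of `G_N` is uniform and
"independent" of every translation-invariant functional (`lintegral_mul_eq_lintegral_mul_of_posShift_ae`,
unsigned; `integral_mul_eq_integral_mul_of_posShift_ae`, signed).  Since every hard-sphere flow on the
torus is translation-COVARIANT almost everywhere (`HardSphereFlow.flow_posShift_ae`, tree), velocity
functionals of the evolved configuration `Φ_t z` are admissible `K`'s: this is the exact MAIN TERM of the
frozen-modulation comparison `V(φ ⊗ g)` vs `(∫φ²)·V(1 ⊗ g)` of the stub (`integral_mul_twoTime_eq`,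
`integral_mul_window_eq`), and the same symmetry serves the sibling stubs of the line.

The translation covariance of the flow itself (trajectories, Liouville measure, a.e. commutation) is the
tree file `Literature.Analysis.FluidPDE.HardSphereTranslation` (`IsHardSphereTrajectory.posShift`,
`HardSphereFlow.measurePreserving_posShift_liouville`, `HardSphereFlow.flow_posShift_ae`).

References: H. Spohn, *Large Scale Dynamics of Interacting Particles* (1991), Part I §2.3 (homogeneous
equilibrium measures); GST 2013 §1.1, §4.2 (homogeneity of the hard-sphere dynamics on `T^d`).
-/

noncomputable section

open MeasureTheory ProbabilityTheory Filter Set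
open scoped ENNReal InnerProductSpace BigOperators
open Literature.Analysis.FluidPDE Literature.MathematicalPhysics.KineticTheory

namespace Summit.AtomisticToContinuum.HydrodynamicLimit.Theorems.ShearStressHalfDrudeMarginal

/-! ## A generic lemma: push-forward of a measure with density under a symmetry -/

/-- If `T` preserves `μ` and the density `F` is `T`-invariant, then `T` preserves `μ.withDensity F`.
[folklore] -/
theorem map_withDensity_eq_of_measurePreserving {α : Type*} [MeasurableSpace α] {μ : Measure α}
    {T : α → α} (hT : MeasurePreserving T μ μ) {F : α → ℝ≥0∞} (hF : Measurable F)
    (hinv : ∀ x, F (T x) = F x) : (μ.withDensity F).map T = μ.withDensity F := by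
  ext s hs
  rw [Measure.map_apply hT.measurable hs, withDensity_apply _ (hT.measurable hs),
    withDensity_apply _ hs, ← lintegral_indicator (hT.measurable hs), ← lintegral_indicator hs]
  have hind : (fun x => (T ⁻¹' s).indicator F x) = fun x => s.indicator F (T x) := by
    funext x
    by_cases hx : T x ∈ s
    · rw [indicator_of_mem (mem_preimage.2 hx), indicator_of_mem hx, hinv]
    · rw [indicator_of_notMem (fun h => hx (mem_preimage.1 h)), indicator_of_notMem hx]
  rw [hind]
  exact hT.lintegral_comp (hF.indicator hs)

/-! ## The homogeneous Gibbs law is translation invariant -/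

/-- For constant profiles the tensor power of the local Gibbs profile only depends on the velocities,
so it is invariant under the diagonal translation of the positions. [folklore] -/
theorem tensorPow_localGibbsProfile_const_posShift (a θ : ℝ) (u : V3) {n : ℕ} (c : T3)
    (z : Config n (Fin 3) T3) :
    tensorPow n (localGibbsProfile (fun _ => a) (fun _ => u) (fun _ => θ))
        (fun i => ((z i).1 + c, (z i).2)) =
      tensorPow n (localGibbsProfile (fun _ => a) (fun _ => u) (fun _ => θ)) z := rfl

/-- The canonical (homogeneous) Gibbs density is invariant under the diagonal translation of the
positions (the hard-sphere domain only sees minimal-image separations,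
`posShift_mem_hardSphereDomain_iff`). [folklore] -/
theorem canonicalDensity_const_posShift (a θ : ℝ) (u : V3) (ε : ℝ) {n : ℕ} (c : T3)
    (z : Config n (Fin 3) T3) :
    canonicalDensity (Torus.geometry (Fin 3)) ε n (localGibbsProfile (fun _ => a) (fun _ => u) (fun _ => θ))
        (fun i => ((z i).1 + c, (z i).2)) =
      canonicalDensity (Torus.geometry (Fin 3)) ε n
        (localGibbsProfile (fun _ => a) (fun _ => u) (fun _ => θ)) z := by
  unfold canonicalDensity
  by_cases hz : z ∈ hardSphereDomain (Torus.geometry (Fin 3)) n ε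
  · rw [indicator_of_mem hz, indicator_of_mem ((posShift_mem_hardSphereDomain_iff c z).2 hz)]
    rfl
  · rw [indicator_of_notMem hz, indicator_of_notMem (mt (posShift_mem_hardSphereDomain_iff c z).1 hz)]

/-- **Translation invariance of the homogeneous Gibbs measure** (flow-free form): for constant profiles
`(T_c)_# G_N = G_N` for every `c ∈ 𝕋³`.  No hypothesis on `σ, a, θ` (in the degenerate cases both sides
are the same junk/zero measure). [folklore] -/
theorem map_posShift_localGibbsMeasure_const (σ a θ : ℝ) (u : V3) (N : ℕ) (c : T3) :
    (localGibbsMeasure σ (fun _ => a) (fun _ => u) (fun _ => θ) N).map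
        (fun z => (fun i => ((z i).1 + c, (z i).2) : Config (N + 1) (Fin 3) T3)) =
      localGibbsMeasure σ (fun _ => a) (fun _ => u) (fun _ => θ) N := by
  unfold localGibbsMeasure
  refine map_withDensity_eq_of_measurePreserving
    (HardSphereFlow.measurePreserving_posShift_volume (d := Fin 3) (N := N + 1) c) ?_ fun z => ?_
  · exact (measurable_canonicalDensity _ _
      (measurable_localGibbsProfile continuous_const continuous_const continuous_const)).ennreal_ofReal
  · rw [canonicalDensity_const_posShift]

/-- **Translation invariance of the homogeneous Gibbs law**: for constant profiles `(a, u, θ)`, every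
`σ, N`, every flow `Φ` (which only fixes the phase space) and every `c ∈ 𝕋³`,
`(T_c)_# (localGibbsLaw σ a u θ N Φ) = localGibbsLaw σ a u θ N Φ`. [folklore] -/
theorem map_posShift_localGibbsLaw_const (σ a θ : ℝ) (u : V3) (N : ℕ)
    (Φ : HardSphereFlow (Torus.geometry (Fin 3)) (hsDiameter σ N) (N + 1)) (c : T3) :
    (localGibbsLaw σ (fun _ => a) (fun _ => u) (fun _ => θ) N Φ).map
        (fun z => (fun i => ((z i).1 + c, (z i).2) : Config (N + 1) (Fin 3) T3)) =
      localGibbsLaw σ (fun _ => a) (fun _ => u) (fun _ => θ) N Φ := by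
  rw [localGibbsLaw_eq]
  exact map_posShift_localGibbsMeasure_const σ a θ u N c

/-- `MeasurePreserving` form of `map_posShift_localGibbsLaw_const`. [folklore] -/
theorem measurePreserving_posShift_localGibbsLaw_const (σ a θ : ℝ) (u : V3) (N : ℕ)
    (Φ : HardSphereFlow (Torus.geometry (Fin 3)) (hsDiameter σ N) (N + 1)) (c : T3) :
    MeasurePreserving (fun z => (fun i => ((z i).1 + c, (z i).2) : Config (N + 1) (Fin 3) T3))
      (localGibbsLaw σ (fun _ => a) (fun _ => u) (fun _ => θ) N Φ)
      (localGibbsLaw σ (fun _ => a) (fun _ => u) (fun _ => θ) N Φ) :=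
  ⟨measurable_posShift c, map_posShift_localGibbsLaw_const σ a θ u N Φ c⟩

/-- Invariance of unsigned Gibbs expectations under the diagonal translation:
`∫⁻ g (T_c z) dG_N = ∫⁻ g dG_N` for measurable `g`. [folklore] -/
theorem lintegral_comp_posShift_localGibbsLaw_const (σ a θ : ℝ) (u : V3) (N : ℕ)
    (Φ : HardSphereFlow (Torus.geometry (Fin 3)) (hsDiameter σ N) (N + 1)) (c : T3)
    {g : Config (N + 1) (Fin 3) T3 → ℝ≥0∞} (hg : Measurable g) :
    ∫⁻ z, g (fun i => ((z i).1 + c, (z i).2)) ∂(localGibbsLaw σ (fun _ => a) (fun _ => u) (fun _ => θ) N Φ) =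
      ∫⁻ z, g z ∂(localGibbsLaw σ (fun _ => a) (fun _ => u) (fun _ => θ) N Φ) :=
  (measurePreserving_posShift_localGibbsLaw_const σ a θ u N Φ c).lintegral_comp hg

/-- Invariance of (Bochner) Gibbs expectations under the diagonal translation:
`∫ f (T_c z) dG_N = ∫ f dG_N` for every `f` (the translation is a measurable equivalence, so no
measurability hypothesis is needed). [folklore] -/
theorem integral_comp_posShift_localGibbsLaw_const {E : Type*} [NormedAddCommGroup E] [NormedSpace ℝ E]
    (σ a θ : ℝ) (u : V3) (N : ℕ)
    (Φ : HardSphereFlow (Torus.geometry (Fin 3)) (hsDiameter σ N) (N + 1)) (c : T3)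
    (f : Config (N + 1) (Fin 3) T3 → E) :
    ∫ z, f (fun i => ((z i).1 + c, (z i).2)) ∂(localGibbsLaw σ (fun _ => a) (fun _ => u) (fun _ => θ) N Φ) =
      ∫ z, f z ∂(localGibbsLaw σ (fun _ => a) (fun _ => u) (fun _ => θ) N Φ) := by
  -- the translation is a measurable equivalence with inverse the translation by `-c`
  set e : Config (N + 1) (Fin 3) T3 ≃ᵐ Config (N + 1) (Fin 3) T3 :=
    { toFun := fun z => fun i => ((z i).1 + c, (z i).2)
      invFun := fun z => fun i => ((z i).1 + -c, (z i).2)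
      left_inv := fun z => by funext i; simp
      right_inv := fun z => by funext i; simp
      measurable_toFun := measurable_posShift c
      measurable_invFun := measurable_posShift (-c) } with he
  have hecoe : (e : Config (N + 1) (Fin 3) T3 → Config (N + 1) (Fin 3) T3) =
      fun z => fun i => ((z i).1 + c, (z i).2) := rfl
  have hP : MeasurePreserving e (localGibbsLaw σ (fun _ => a) (fun _ => u) (fun _ => θ) N Φ)
      (localGibbsLaw σ (fun _ => a) (fun _ => u) (fun _ => θ) N Φ) := by
    rw [hecoe]
    exact measurePreserving_posShift_localGibbsLaw_const σ a θ u N Φ c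
  exact hP.integral_comp' f

/-- Every hard-sphere flow is translation-COVARIANT `G_N`-almost everywhere (for arbitrary profiles: the
local Gibbs law is absolutely continuous with respect to the Liouville measure, and
`HardSphereFlow.flow_posShift_ae`). [folklore] -/
theorem flow_posShift_ae_localGibbsLaw (σ : ℝ) (a₀ θ₀ : T3 → ℝ) (u₀ : T3 → V3) (N : ℕ)
    (Φ : HardSphereFlow (Torus.geometry (Fin 3)) (hsDiameter σ N) (N + 1)) (c : T3) (t : ℝ) :
    ∀ᵐ z ∂(localGibbsLaw σ a₀ u₀ θ₀ N Φ),
      Φ.flow t (fun i => ((z i).1 + c, (z i).2)) = fun i => ((Φ.flow t z i).1 + c, (Φ.flow t z i).2) := by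
  rw [localGibbsLaw_eq]
  exact (localGibbsMeasure_absolutelyContinuous σ a₀ u₀ θ₀ N Φ).ae_le (Φ.flow_posShift_ae c t)

/-- Every hard-sphere flow is translation-covariant **at all forward times simultaneously**,
`G_N`-almost everywhere: for `G_N`-a.e. `z`, `Φ_t (T_c z) = T_c (Φ_t z)` for every `t ≥ 0` (forward
uniqueness on the `G_N`-conull set of good `z` with good translate, `HardSphereFlow.flow_posShift_of_nonneg`).
This is the form consumed by time-window functionals. [folklore] -/
theorem ae_forall_flow_posShift_of_nonneg_localGibbsLaw (σ : ℝ) (a₀ θ₀ : T3 → ℝ) (u₀ : T3 → V3) (N : ℕ)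
    (Φ : HardSphereFlow (Torus.geometry (Fin 3)) (hsDiameter σ N) (N + 1)) (c : T3) :
    ∀ᵐ z ∂(localGibbsLaw σ a₀ u₀ θ₀ N Φ), ∀ t : ℝ, 0 ≤ t →
      Φ.flow t (fun i => ((z i).1 + c, (z i).2)) = fun i => ((Φ.flow t z i).1 + c, (Φ.flow t z i).2) := by
  rw [localGibbsLaw_eq]
  refine (localGibbsMeasure_absolutelyContinuous σ a₀ u₀ θ₀ N Φ).ae_le ?_
  filter_upwards [Φ.ae_mem_good, Φ.ae_posShift_mem_good c] with z hz hzc t ht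
  exact Φ.flow_posShift_of_nonneg c hz hzc ht

/-! ## The uniform one-point marginal: factorisation of translation-invariant functionals -/

section Instances

/-- The local Gibbs law is s-finite (it has a density with respect to Lebesgue measure). [folklore] -/
theorem sFinite_localGibbsLaw (σ : ℝ) (a₀ θ₀ : T3 → ℝ) (u₀ : T3 → V3) (N : ℕ)
    (Φ : HardSphereFlow (Torus.geometry (Fin 3)) (hsDiameter σ N) (N + 1)) :
    SFinite (localGibbsLaw σ a₀ u₀ θ₀ N Φ) := by
  haveI hXE : SigmaFinite (volume : Measure (T3 × V3)) := inferInstance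
  haveI hC : SigmaFinite (volume : Measure (Config (N + 1) (Fin 3) T3)) := inferInstance
  rw [localGibbsLaw_eq]
  unfold localGibbsMeasure
  infer_instance

end Instances

/-- **Factorisation, unsigned form.** For constant profiles, a measurable `K ≥ 0` which is invariant
under every diagonal translation `G_N`-a.e. (`K ∘ T_c = K` a.e., each `c`), a measurable `ψ ≥ 0` on
`𝕋³` and a particle `i`:  `∫⁻ ψ(xᵢ) K dG_N = (∫⁻_{𝕋³} ψ) · ∫⁻ K dG_N`.  Proof: by translation
invariance of `G_N`, `∫⁻ ψ(xᵢ + c) K dG_N` does not depend on `c`; average over `c ∈ 𝕋³`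
(`volume 𝕋³ = 1`), swap the integrals (Tonelli) and use `∫⁻ ψ(x + c) dc = ∫⁻ ψ` (Haar). [folklore] -/
theorem lintegral_mul_eq_lintegral_mul_of_posShift_ae (σ a θ : ℝ) (u : V3) (N : ℕ)
    (Φ : HardSphereFlow (Torus.geometry (Fin 3)) (hsDiameter σ N) (N + 1))
    {K : Config (N + 1) (Fin 3) T3 → ℝ≥0∞} (hK : Measurable K)
    (hKinv : ∀ c : T3, ∀ᵐ z ∂(localGibbsLaw σ (fun _ => a) (fun _ => u) (fun _ => θ) N Φ),
      K (fun i => ((z i).1 + c, (z i).2)) = K z)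
    {ψ : T3 → ℝ≥0∞} (hψ : Measurable ψ) (i : Fin (N + 1)) :
    ∫⁻ z, ψ (z i).1 * K z ∂(localGibbsLaw σ (fun _ => a) (fun _ => u) (fun _ => θ) N Φ) =
      (∫⁻ x, ψ x) * ∫⁻ z, K z ∂(localGibbsLaw σ (fun _ => a) (fun _ => u) (fun _ => θ) N Φ) := by
  set G := localGibbsLaw σ (fun _ => a) (fun _ => u) (fun _ => θ) N Φ with hG
  haveI : SFinite G := sFinite_localGibbsLaw σ _ _ _ N Φ
  have hm : Measurable fun z : Config (N + 1) (Fin 3) T3 => ψ (z i).1 * K z :=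
    (hψ.comp (measurable_pi_apply i).fst).mul hK
  -- Step 1: the translated functional has the same expectation
  have h1 : ∀ c : T3, ∫⁻ z, ψ ((z i).1 + c) * K z ∂G = ∫⁻ z, ψ (z i).1 * K z ∂G := by
    intro c
    calc ∫⁻ z, ψ ((z i).1 + c) * K z ∂G
        = ∫⁻ z, ψ ((z i).1 + c) * K (fun j => ((z j).1 + c, (z j).2)) ∂G :=
          lintegral_congr_ae ((hKinv c).mono fun z hz => by simp only [hz])
      _ = ∫⁻ z, ψ (z i).1 * K z ∂G :=
          (measurePreserving_posShift_localGibbsLaw_const σ a θ u N Φ c).lintegral_comp hm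
  -- Step 2: average over `c`, Tonelli, Haar invariance on `𝕋³`
  have hunc : Measurable (Function.uncurry fun (c : T3) (z : Config (N + 1) (Fin 3) T3) =>
      ψ ((z i).1 + c) * K z) :=
    (hψ.comp (((measurable_pi_apply i).comp measurable_snd).fst.add measurable_fst)).mul
      (hK.comp measurable_snd)
  calc ∫⁻ z, ψ (z i).1 * K z ∂G
      = ∫⁻ _c : T3, ∫⁻ z, ψ (z i).1 * K z ∂G := by
        rw [lintegral_const, measure_univ, mul_one]
    _ = ∫⁻ c : T3, ∫⁻ z, ψ ((z i).1 + c) * K z ∂G := lintegral_congr fun c => (h1 c).symm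
    _ = ∫⁻ z, (∫⁻ c : T3, ψ ((z i).1 + c) * K z) ∂G := lintegral_lintegral_swap hunc.aemeasurable
    _ = ∫⁻ z, (∫⁻ x, ψ x) * K z ∂G := by
        refine lintegral_congr fun z => ?_
        have hψc : Measurable fun c : T3 => ψ ((z i).1 + c) := hψ.comp (measurable_const_add _)
        rw [lintegral_mul_const _ hψc, lintegral_add_left_eq_self]
    _ = (∫⁻ x, ψ x) * ∫⁻ z, K z ∂G := lintegral_const_mul _ hK

/-- **Factorisation, unsigned form, everywhere-invariant `K`** (`K ∘ T_c = K` for all `c`). [folklore] -/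
theorem lintegral_mul_eq_lintegral_mul_of_posShift (σ a θ : ℝ) (u : V3) (N : ℕ)
    (Φ : HardSphereFlow (Torus.geometry (Fin 3)) (hsDiameter σ N) (N + 1))
    {K : Config (N + 1) (Fin 3) T3 → ℝ≥0∞} (hK : Measurable K)
    (hKinv : ∀ (c : T3) (z : Config (N + 1) (Fin 3) T3), K (fun i => ((z i).1 + c, (z i).2)) = K z)
    {ψ : T3 → ℝ≥0∞} (hψ : Measurable ψ) (i : Fin (N + 1)) :
    ∫⁻ z, ψ (z i).1 * K z ∂(localGibbsLaw σ (fun _ => a) (fun _ => u) (fun _ => θ) N Φ) =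
      (∫⁻ x, ψ x) * ∫⁻ z, K z ∂(localGibbsLaw σ (fun _ => a) (fun _ => u) (fun _ => θ) N Φ) :=
  lintegral_mul_eq_lintegral_mul_of_posShift_ae σ a θ u N Φ hK
    (fun c => ae_of_all _ fun z => hKinv c z) hψ i

/-- **Factorisation, signed form.** For constant profiles, an integrable real `K` which is invariant
under every diagonal translation `G_N`-a.e., a bounded measurable `ψ : 𝕋³ → ℝ` and a particle `i`:
`∫ ψ(xᵢ) K dG_N = (∫_{𝕋³} ψ) · ∫ K dG_N`  (`E_G[ψ(xᵢ) K] = (∫ψ) E_G[K]`; Fubini on `𝕋³ × Config`,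
the integrand being dominated by `‖ψ‖_∞ |K|`). [folklore] -/
theorem integral_mul_eq_integral_mul_of_posShift_ae (σ a θ : ℝ) (u : V3) (N : ℕ)
    (Φ : HardSphereFlow (Torus.geometry (Fin 3)) (hsDiameter σ N) (N + 1))
    {K : Config (N + 1) (Fin 3) T3 → ℝ}
    (hK : Integrable K (localGibbsLaw σ (fun _ => a) (fun _ => u) (fun _ => θ) N Φ))
    (hKinv : ∀ c : T3, ∀ᵐ z ∂(localGibbsLaw σ (fun _ => a) (fun _ => u) (fun _ => θ) N Φ),
      K (fun i => ((z i).1 + c, (z i).2)) = K z)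
    {ψ : T3 → ℝ} (hψ : Measurable ψ) {C : ℝ} (hψC : ∀ x, |ψ x| ≤ C) (i : Fin (N + 1)) :
    ∫ z, ψ (z i).1 * K z ∂(localGibbsLaw σ (fun _ => a) (fun _ => u) (fun _ => θ) N Φ) =
      (∫ x, ψ x) * ∫ z, K z ∂(localGibbsLaw σ (fun _ => a) (fun _ => u) (fun _ => θ) N Φ) := by
  set G := localGibbsLaw σ (fun _ => a) (fun _ => u) (fun _ => θ) N Φ with hG
  haveI : SFinite G := sFinite_localGibbsLaw σ _ _ _ N Φ
  -- Step 1: the translated functional has the same expectation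
  have h1 : ∀ c : T3, ∫ z, ψ ((z i).1 + c) * K z ∂G = ∫ z, ψ (z i).1 * K z ∂G := by
    intro c
    calc ∫ z, ψ ((z i).1 + c) * K z ∂G
        = ∫ z, ψ ((z i).1 + c) * K (fun j => ((z j).1 + c, (z j).2)) ∂G :=
          integral_congr_ae ((hKinv c).mono fun z hz => by simp only [hz])
      _ = ∫ z, ψ (z i).1 * K z ∂G :=
          integral_comp_posShift_localGibbsLaw_const σ a θ u N Φ c (fun z => ψ (z i).1 * K z)
  -- Step 2: integrability on `𝕋³ × Config` and Fubini
  have hmeas : Measurable fun p : T3 × Config (N + 1) (Fin 3) T3 => ψ ((p.2 i).1 + p.1) :=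
    hψ.comp (((measurable_pi_apply i).comp measurable_snd).fst.add measurable_fst)
  have hint : Integrable (Function.uncurry fun (c : T3) (z : Config (N + 1) (Fin 3) T3) =>
      ψ ((z i).1 + c) * K z) ((volume : Measure T3).prod G) := by
    refine Integrable.bdd_mul (c := C) (hK.comp_snd volume) hmeas.aestronglyMeasurable
      (ae_of_all _ fun p => ?_)
    rw [Real.norm_eq_abs]
    exact hψC _
  calc ∫ z, ψ (z i).1 * K z ∂G
      = ∫ _c : T3, ∫ z, ψ (z i).1 * K z ∂G := by
        rw [integral_const, probReal_univ, one_smul]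
    _ = ∫ c : T3, ∫ z, ψ ((z i).1 + c) * K z ∂G := integral_congr_ae (ae_of_all _ fun c => (h1 c).symm)
    _ = ∫ z, (∫ c : T3, ψ ((z i).1 + c) * K z) ∂G := integral_integral_swap hint
    _ = ∫ z, (∫ x, ψ x) * K z ∂G := by
        refine integral_congr_ae (ae_of_all _ fun z => ?_)
        dsimp only
        rw [integral_mul_const, integral_add_left_eq_self]
    _ = (∫ x, ψ x) * ∫ z, K z ∂G := integral_const_mul _ _

/-- **Factorisation, signed form, everywhere-invariant `K`**. [folklore] -/
theorem integral_mul_eq_integral_mul_of_posShift (σ a θ : ℝ) (u : V3) (N : ℕ)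
    (Φ : HardSphereFlow (Torus.geometry (Fin 3)) (hsDiameter σ N) (N + 1))
    {K : Config (N + 1) (Fin 3) T3 → ℝ}
    (hK : Integrable K (localGibbsLaw σ (fun _ => a) (fun _ => u) (fun _ => θ) N Φ))
    (hKinv : ∀ (c : T3) (z : Config (N + 1) (Fin 3) T3), K (fun i => ((z i).1 + c, (z i).2)) = K z)
    {ψ : T3 → ℝ} (hψ : Measurable ψ) {C : ℝ} (hψC : ∀ x, |ψ x| ≤ C) (i : Fin (N + 1)) :
    ∫ z, ψ (z i).1 * K z ∂(localGibbsLaw σ (fun _ => a) (fun _ => u) (fun _ => θ) N Φ) =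
      (∫ x, ψ x) * ∫ z, K z ∂(localGibbsLaw σ (fun _ => a) (fun _ => u) (fun _ => θ) N Φ) :=
  integral_mul_eq_integral_mul_of_posShift_ae σ a θ u N Φ hK
    (fun c => ae_of_all _ fun z => hKinv c z) hψ hψC i

/-! ## The main term of the frozen-modulation comparison (exact identities) -/

/-- **MAIN TERM, two-time form.** For constant profiles, a time `t`, a real two-time functional `F z w`
invariant under the SIMULTANEOUS diagonal translation of both configurations (e.g. any function of the
velocities of `z` and `w`, such as `g(wᵢ(z)) Σⱼ g(wⱼ(w))`), with `z ↦ F z (Φ_t z)` integrable, a bounded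
measurable `ψ` (e.g. `φ²`) and a particle `i`:
`∫ ψ(xᵢ) F(z, Φ_t z) dG_N = (∫_{𝕋³} ψ) · ∫ F(z, Φ_t z) dG_N` — in the notation of the stub,
`Σⱼ E[φ(xᵢ)² g(wᵢ) g(wⱼ(t))] = (∫φ²) Σⱼ E[g(wᵢ) g(wⱼ(t))]` (sum over `i` to get `(∫φ²)·C_1(t)`).
The flow enters only through its a.e. translation covariance. [folklore] -/
theorem integral_mul_twoTime_eq (σ a θ : ℝ) (u : V3) (N : ℕ)
    (Φ : HardSphereFlow (Torus.geometry (Fin 3)) (hsDiameter σ N) (N + 1)) (t : ℝ)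
    {F : Config (N + 1) (Fin 3) T3 → Config (N + 1) (Fin 3) T3 → ℝ}
    (hF : ∀ (c : T3) (z w : Config (N + 1) (Fin 3) T3),
      F (fun i => ((z i).1 + c, (z i).2)) (fun i => ((w i).1 + c, (w i).2)) = F z w)
    (hint : Integrable (fun z => F z (Φ.flow t z)) (localGibbsLaw σ (fun _ => a) (fun _ => u) (fun _ => θ) N Φ))
    {ψ : T3 → ℝ} (hψ : Measurable ψ) {C : ℝ} (hψC : ∀ x, |ψ x| ≤ C) (i : Fin (N + 1)) :
    ∫ z, ψ (z i).1 * F z (Φ.flow t z) ∂(localGibbsLaw σ (fun _ => a) (fun _ => u) (fun _ => θ) N Φ) =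
      (∫ x, ψ x) * ∫ z, F z (Φ.flow t z) ∂(localGibbsLaw σ (fun _ => a) (fun _ => u) (fun _ => θ) N Φ) := by
  refine integral_mul_eq_integral_mul_of_posShift_ae σ a θ u N Φ hint (fun c => ?_) hψ hψC i
  filter_upwards [flow_posShift_ae_localGibbsLaw σ (fun _ => a) (fun _ => θ) (fun _ => u) N Φ c t] with z hz
  rw [hz, hF]

/-- **MAIN TERM, time-window form.** Same as `integral_mul_twoTime_eq` with the two-time functional
integrated over a forward time window `s ∈ [0, h]` (e.g. `F z w = g(wᵢ(z)) · Σⱼ g(wⱼ(w))`, giving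
`E[φ(xᵢ)² g(wᵢ) ∫₀ʰ Σⱼ g(wⱼ(s)) ds] = (∫φ²) E[g(wᵢ) ∫₀ʰ Σⱼ g(wⱼ(s)) ds]`): the window integral
`z ↦ ∫₀ʰ F(z, Φ_s z) ds` is translation invariant `G_N`-a.e. by covariance at all forward times
(`ae_forall_flow_posShift_of_nonneg_localGibbsLaw`). [folklore] -/
theorem integral_mul_window_eq (σ a θ : ℝ) (u : V3) (N : ℕ)
    (Φ : HardSphereFlow (Torus.geometry (Fin 3)) (hsDiameter σ N) (N + 1)) {h : ℝ} (hh : 0 ≤ h)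
    {F : Config (N + 1) (Fin 3) T3 → Config (N + 1) (Fin 3) T3 → ℝ}
    (hF : ∀ (c : T3) (z w : Config (N + 1) (Fin 3) T3),
      F (fun i => ((z i).1 + c, (z i).2)) (fun i => ((w i).1 + c, (w i).2)) = F z w)
    (hint : Integrable (fun z => ∫ s in (0 : ℝ)..h, F z (Φ.flow s z))
      (localGibbsLaw σ (fun _ => a) (fun _ => u) (fun _ => θ) N Φ))
    {ψ : T3 → ℝ} (hψ : Measurable ψ) {C : ℝ} (hψC : ∀ x, |ψ x| ≤ C) (i : Fin (N + 1)) :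
    ∫ z, ψ (z i).1 * (∫ s in (0 : ℝ)..h, F z (Φ.flow s z))
        ∂(localGibbsLaw σ (fun _ => a) (fun _ => u) (fun _ => θ) N Φ) =
      (∫ x, ψ x) * ∫ z, (∫ s in (0 : ℝ)..h, F z (Φ.flow s z))
        ∂(localGibbsLaw σ (fun _ => a) (fun _ => u) (fun _ => θ) N Φ) := by
  refine integral_mul_eq_integral_mul_of_posShift_ae σ a θ u N Φ hint (fun c => ?_) hψ hψC i
  filter_upwards [ae_forall_flow_posShift_of_nonneg_localGibbsLaw σ (fun _ => a) (fun _ => θ) (fun _ => u)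
    N Φ c] with z hz
  refine intervalIntegral.integral_congr fun s hs => ?_
  rw [uIcc_of_le hh] at hs
  rw [hz s hs.1, hF]

/-- **Registered form of the main-term identity** (sub-stub `stub_frozenModulationMainTerm` of crux
stmt-AtomisticToContinuum-14136, line `cutoff-compactness-net`, serving `stub_frozenModulation`): the
time-window factorisation `∫ ψ(xᵢ)·(∫₀ʰ F(z, Φ_s z) ds) dG_N = (∫ψ)·∫ (∫₀ʰ F(z, Φ_s z) ds) dG_N` for every
two-time functional `F` invariant under the simultaneous diagonal translation, all binders explicit. [folklore] -/
theorem stub_frozenModulationMainTerm :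
    ∀ (σ a θ : ℝ) (u : V3) (N : ℕ)
      (Φ : HardSphereFlow (Torus.geometry (Fin 3)) (hsDiameter σ N) (N + 1)) (h : ℝ), 0 ≤ h →
    ∀ (F : Config (N + 1) (Fin 3) T3 → Config (N + 1) (Fin 3) T3 → ℝ),
      (∀ (c : T3) (z w : Config (N + 1) (Fin 3) T3),
        F (fun i => ((z i).1 + c, (z i).2)) (fun i => ((w i).1 + c, (w i).2)) = F z w) →
      Integrable (fun z => ∫ s in (0 : ℝ)..h, F z (Φ.flow s z))
        (localGibbsLaw σ (fun _ => a) (fun _ => u) (fun _ => θ) N Φ) →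
    ∀ (ψ : T3 → ℝ), Measurable ψ → ∀ (C : ℝ), (∀ x, |ψ x| ≤ C) → ∀ (i : Fin (N + 1)),
      ∫ z, ψ (z i).1 * (∫ s in (0 : ℝ)..h, F z (Φ.flow s z))
          ∂(localGibbsLaw σ (fun _ => a) (fun _ => u) (fun _ => θ) N Φ) =
        (∫ x, ψ x) * ∫ z, (∫ s in (0 : ℝ)..h, F z (Φ.flow s z))
          ∂(localGibbsLaw σ (fun _ => a) (fun _ => u) (fun _ => θ) N Φ) :=
  fun σ a θ u N Φ _h hh _F hF hint _ψ hψ _C hψC i =>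
    integral_mul_window_eq σ a θ u N Φ hh hF hint hψ hψC i

end Summit.AtomisticToContinuum.HydrodynamicLimit.Theorems.ShearStressHalfDrudeMarginal

end
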